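import Summits.HodgeConjecture.Statement
import Summits.HodgeConjecture.HodgeConjecture.Theorems.WeilTypeLadder
import Summits.HodgeConjecture.HodgeConjecture.Theorems.WeilTypeLadderVariational
import Summits.HodgeConjecture.HodgeConjecture.Theorems.WeilTypeLadderAnchors
import Summits.HodgeConjecture.HodgeConjecture.Theorems.WeilTypeLadderVariationalLocal
import Summits.HodgeConjecture.HodgeConjecture.Theorems.AnchorTransportVariationalHodgeTrivialFamily
import Literature.AlgebraicGeometry.HodgeTheory.MotivatedClassesDeformationCurves
import Literature.AlgebraicGeometry.HodgeTheory.QuasiProjectiveOfAffine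
import Literature.AlgebraicGeometry.HodgeTheory.IsoTransport
import Literature.AlgebraicGeometry.Motives.AbelianVarietyProjectiveChart
import HarnessLib

/-!
# WeilTypeLadder · R3anc ON-PATH lemma and the glue R3 ⟸ R3anc ∧ R3var (b2b cell `hweil`, prover 2)

For the anchor-supply leaf `WeilTypeLadder.AnchoredWeilFamiliesCMField` (R3anc,
`Theorems/WeilTypeLadderAnchors.lean`):

* `anchoredWeilFamiliesCMField_of_hodgeConjecture` — ON-PATH LEMMA `HodgeConjecture → R3anc` (TYPE II
  ladder): under HC the class `c` is algebraic on `A`, and the CONSTANT family `A.X ⟶ Spec ℂ`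
  (`toSpecOver`, a smooth projective family whose fibre inclusions are isomorphisms —
  `isSmoothProjectiveFamily_toSpecOver'`, `isIso_fiberι_toSpecOver'` of
  `AnchorTransportVariationalHodgeTrivialFamily`; base `Spec ℂ` quasi-projective, smooth, irreducible;
  `A.X` projective by `AbelianVariety.isProjectiveOver_holds`) anchored at its unique point is a witness.
* `weilClassesCMField_of_anchored_of_variational` — the GLUE: R3anc ∧ R3var ⟹ R3. Given a non-zero
  rational `(m,m)` Weil class `c` (zero classes and `m = 0` are trivial: `algebraicClasses_zero`), take the
  anchored family through `c`; R3var transports algebraicity from the anchor `s₀` to `s₁`; read it back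
  on `A` through `ι : A.X ≅ 𝒳_{s₁}` (`mem_algebraicClasses_map_iff_of_iso`).

So the CM rung R3 is, in the tree, EXACTLY the conjunction of two typed open leaves, both cases of HC:
anchor supply (Markman's product points + generic `B`-secant sheaves, companion §12 / Lemma 10.2.3) and
Weil-confined variational Hodge (whose engine interface is LOCAL-R3var,
`Theorems/WeilTypeLadderVariationalLocal.lean`). Serves stmt-HodgeConjecture-14497. Sorry-free; no definition.
-/

-- every declaration of this problem lives in `Summit.HodgeConjecture.HodgeConjecture.…` (summit = sub-problem)
set_option linter.dupNamespace false

noncomputable section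

open CategoryTheory AlgebraicGeometry

namespace Summit.HodgeConjecture.HodgeConjecture.WeilTypeLadder

open Literature.AlgebraicGeometry Literature.AlgebraicGeometry.Motives
open Literature.AlgebraicGeometry.HodgeTheory
open Literature.AlgebraicTopology.SingularHomology
open Summit.HodgeConjecture.HodgeConjecture.Theorems

/-- **On-path lemma: the Hodge conjecture implies R3anc** — the constant family `A.X ⟶ Spec ℂ` anchored
at `A` itself: `c` is algebraic by HC, every fibre inclusion is an isomorphism (so the fibre class is
rational `(m,m)` and Weil-confined through the chart `(fiberι)⁻¹`, and reads back to `c`), `Spec ℂ` is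
quasi-projective, smooth and irreducible, `A.X` is projective. [folklore] -/
theorem anchoredWeilFamiliesCMField_of_hodgeConjecture (h : _root_.HodgeConjecture) :
    AnchoredWeilFamiliesCMField := by
  intro A φ P e m _ _ _ _ hφ hdim _ _ c hc hcQ hcH _
  have hA : IsSmoothProjective A.dim A.X := AbelianVariety.isSmoothProjective_holds (A := A)
  have hA'dim : A.dim = e * m := by
    have h2 : e * (2 * m) = 2 * (e * m) := by ring
    omega
  have hX : IsSmoothProjective (e * m) A.X := hA'dim ▸ hA
  -- the constant family over `Spec ℂ`
  have hfam : IsSmoothProjectiveFamily (toSpecOver A.X) (e * m) := isSmoothProjectiveFamily_toSpecOver' hX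
  let s : ComplexPoints (specOver ℂ ℂ) := 𝟙 (specOver ℂ ℂ)
  haveI : ∀ t : ComplexPoints (specOver ℂ ℂ), IsIso (fiberι (toSpecOver A.X) t) :=
    fun t => isIso_fiberι_toSpecOver' (X := A.X) t
  let ι : A.X ≅ fiberOver (toSpecOver A.X) s := (asIso (fiberι (toSpecOver A.X) s)).symm
  have halg : c ∈ algebraicClasses A.X m := (h hA).2 m c hcQ hcH
  -- reading a fibre class back through the inverse of the fibre inclusion
  have hback : ∀ t : ComplexPoints (specOver ℂ ℂ),
      complexBetti.map (asIso (fiberι (toSpecOver A.X) t)).symm.hom (2 * m)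
        (complexBetti.map (fiberι (toSpecOver A.X) t) (2 * m) c) = c := fun t => by
    change (complexBetti.map (asIso (fiberι (toSpecOver A.X) t)).hom (2 * m) ≫
      complexBetti.map (asIso (fiberι (toSpecOver A.X) t)).inv (2 * m)) c = c
    rw [← complexBetti.map_comp, Iso.inv_hom_id, complexBetti.map_id]
    rfl
  refine ⟨A.X, specOver ℂ ℂ, toSpecOver A.X, s, s, ι, c, hfam,
    IsQuasiProjectiveOver.of_isProjectiveOver hA.isProjectiveOver, IsQuasiProjectiveOver.specOver,
    inferInstanceAs (IrreducibleSpace (PrimeSpectrum ℂ)), ?_, ?_, ?_, hback s, ?_⟩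
  · haveI : IsIso (specOver ℂ ℂ).hom := by rw [specOver_hom_eq_id]; exact IsIso.id _
    infer_instance
  · intro t
    exact ⟨hcQ.pullback _, IsOfHodgeType.map_of_iso (asIso (fiberι (toSpecOver A.X) t)) (hA'dim ▸ hcH)⟩
  · intro t
    refine ⟨A, φ, (asIso (fiberι (toSpecOver A.X) t)).symm, hφ, hdim, ?_⟩
    rw [hback t]
    exact hc
  · exact (mem_algebraicClasses_map_iff_of_iso (asIso (fiberι (toSpecOver A.X) s))).2 halg

/-- **Glue: anchor supply and Weil-confined variational Hodge give the CM rung** —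
`AnchoredWeilFamiliesCMField → WeilVariationalHodgeCMField → WeilClassesCMField`. For a rational
`(m,m)` Weil class `c`: if `c = 0` or `m = 0` the conclusion is immediate (`algebraicClasses_zero`);
otherwise R3anc supplies a family through `c` with an algebraic anchor, R3var (with `1 ≤ m`) makes
`W|_{𝒳_{s₁}}` algebraic, and `c = ι^*(W|_{𝒳_{s₁}})` is algebraic by transport along `ι`.
[cite: Markman2025SecantRealMultiplication, Thm. 1.1.2 and Cor. 11.2.4] -/
theorem weilClassesCMField_of_anchored_of_variational (hA : AnchoredWeilFamiliesCMField)
    (hV : WeilVariationalHodgeCMField) : WeilClassesCMField := by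
  intro A φ P e m hP hPe he hirr hφ hdim hnr hQ c hc hcQ hcH
  by_cases hc0 : c = 0
  · rw [hc0]; exact Submodule.zero_mem _
  rcases Nat.eq_zero_or_pos m with hm0 | hm
  · subst hm0
    rw [algebraicClasses_zero]
    exact Submodule.mem_top
  obtain ⟨𝒳, S, f, s₁, s₀, ι, W, hf, h𝒳, hS, hirrS, hsm, hW, hWeil, hread, hs₀⟩ :=
    hA A φ P e m hP hPe he hirr hφ hdim hnr hQ c hc hcQ hcH hc0
  haveI := hirrS
  have h1 : complexBetti.map (fiberι f s₁) (2 * m) W ∈ algebraicClasses (fiberOver f s₁) m :=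
    hV P e m hP hPe hirr hnr hQ hm f hf h𝒳 hS hirrS hsm W hW hWeil ⟨s₀, hs₀⟩ s₁
  rw [← hread]
  exact (mem_algebraicClasses_map_iff_of_iso ι).2 h1

/-- **The CM rung from anchor supply and a LOCAL transport engine**: R3anc together with the LOCAL form
of R3var (one algebraic fibre forces a non-empty Euclidean-open set of algebraic fibres — the output of a
semiregularity / secant-sheaf engine) gives `WeilClassesCMField`, through
`weilVariationalHodgeCMField_of_local` (Baire + Charles–Schnell, `Theorems/WeilTypeLadderVariationalLocal.lean`)
and the glue. This is the precise shape of Markman's CM programme (arXiv:2509.23079 §1.1, §12; survey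
arXiv:2509.23403 §2, §12) on the tree's carriers: product/secant anchors + local deformation of a sheaf.
[cite: Markman2025SecantRealMultiplication, Thm. 1.1.2 and Cor. 11.2.4] [cite: CharlesSchnell2014Notes, Prop. 11.3.11 (proof)] -/
theorem weilClassesCMField_of_anchored_of_local (hA : AnchoredWeilFamiliesCMField)
    (hloc : ∀ (P : Polynomial ℤ) (e m : ℕ), P.Monic → P.natDegree = e →
      Irreducible (P.map (Int.castRingHom ℚ)) →
      (∀ ρ : ℂ, Polynomial.eval₂ (Int.castRingHom ℂ) ρ P = 0 → starRingEnd ℂ ρ ≠ ρ) →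
      (∃ Q : Polynomial ℚ, ∀ ρ : ℂ, Polynomial.eval₂ (Int.castRingHom ℂ) ρ P = 0 →
          Polynomial.eval₂ (algebraMap ℚ ℂ) ρ Q = starRingEnd ℂ ρ) →
      1 ≤ m →
      ∀ ⦃𝒳 S : Motives.SchemeOver ℂ⦄ (f : 𝒳 ⟶ S), Motives.IsSmoothProjectiveFamily f (e * m) →
        IsQuasiProjectiveOver 𝒳 → IsQuasiProjectiveOver S → IrreducibleSpace S.left →
        AlgebraicGeometry.Smooth S.hom →
        ∀ (W : complexBetti 𝒳 (2 * m)),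
          (∀ s : Motives.ComplexPoints S,
            IsRationalClass (complexBetti.map (Motives.fiberι f s) (2 * m) W) ∧
              IsOfHodgeType (e * m) (Motives.fiberOver f s) (2 * m) m m
                (complexBetti.map (Motives.fiberι f s) (2 * m) W)) →
          (∀ s : Motives.ComplexPoints S, ∃ (A' : Motives.AbelianVariety ℂ) (φ' : A' ⟶ A')
              (e' : A'.X ≅ Motives.fiberOver f s),
            Polynomial.eval₂ (Int.castRingHom (CategoryTheory.End A')) (φ' : CategoryTheory.End A') P = 0 ∧
              e * (2 * m) = 2 * A'.dim ∧
              complexBetti.map e'.hom (2 * m) (complexBetti.map (Motives.fiberι f s) (2 * m) W) ∈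
                weilClassesField A' φ' P (2 * m)) →
          (∃ s₀ : Motives.ComplexPoints S,
            complexBetti.map (Motives.fiberι f s₀) (2 * m) W ∈
              algebraicClasses (Motives.fiberOver f s₀) m) →
          ∃ U : Set (Motives.ComplexPoints S), IsOpen U ∧ U.Nonempty ∧
            ∀ t ∈ U, complexBetti.map (Motives.fiberι f t) (2 * m) W ∈
              algebraicClasses (Motives.fiberOver f t) m) :
    WeilClassesCMField :=
  weilClassesCMField_of_anchored_of_variational hA (weilVariationalHodgeCMField_of_local hloc)

end Summit.HodgeConjecture.HodgeConjecture.WeilTypeLadder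

end
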